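import Mathlib
import HarnessLib
import Literature.AlgebraicGeometry.Ramification.InertiaNormalSylow
import Literature.AlgebraicGeometry.Resolution.BlowupSNC
import Literature.AlgebraicGeometry.Resolution.BoundarySplitting
import Literature.AlgebraicGeometry.Resolution.CanonicalResolutionSmoothCentre
import Literature.AlgebraicGeometry.Resolution.MarkedIdealsLemmas
import Summits.ResolutionOfSingularities.ResolutionOfSingularities.Theorems.WildQuotientsWildQuotientResolutionStandardFormStableLines
import Summits.ResolutionOfSingularities.ResolutionOfSingularities.Theorems.WildQuotientsWildQuotientResolutionTameCentreStableDivisor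

/-!
# A tame inert locus has simple normal crossings with a stable SNC boundary divisor (scheme level)
# (crux `WildQuotients.WildQuotientResolution`, stub `stub_phaseZeroHighDim`; any dimension)

Crux stmt-ResolutionOfSingularities-15640 (`WildQuotientResolution`), registered stub `stub_phaseZeroHighDim`.
The second move of a multi-move p-standardisation blows up the reduced inert locus `Z_K` of a tame subgroup on a
model that already carries a boundary divisor `D` (the exceptional divisor of the first move). For the boundary
to stay a simple normal crossings divisor (✓`HasSNCWith.hasSNC_transform`, tree BlowupSNC) the centre must have
simple normal crossings with `[D]`. This file proves it when `D` is a simple normal crossings divisor whose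
support is STABLE under the group (as the exceptional divisor of a `G`-stable centre is):

**Theorem** (`hasSNCWith_inertLocus_of_hasSNC_singleton`). `G` acts on the locally Noetherian scheme `X` with residue characteristic `p`; `K ≤ G` has order prime to `p`; `Z_K = {y | K ≤ I_y}` is
closed; `D` is an ideal sheaf with `HasSNC [D]` and `(σ g)⁻¹ supp D = supp D` for all `g`. Then
`HasSNCWith [D] (𝓘_{Z_K})`. (At `x ∈ Z_K ∩ supp D`: `I(D)_x = (t)` is stable on the nose under the stalk action
of `I_x ⊇ K` (✓`StandardFormStableLines`), so ✓`exists_rsop_label_of_stableLine` gives a minimal basis through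
`t` generating `(𝓘_{Z_K})_x = ⨆ 𝔞_k` (✓`InertLocusStalk`); elsewhere ✓`exists_rsop_of_isRegularLocalRing_quotient`
or the given snc data.)

Also the support bookkeeping of a blow-up used by the persistence step of multi-move slices:
`preimage_support_subset_strict_union_exceptional` — `π⁻¹(supp K) ⊆ supp(strict transform of K) ∪ supp(exceptional)`.

[OURS · crux stmt-ResolutionOfSingularities-15640 · helper toward `stub_phaseZeroHighDim` (SNC input of multi-move
slices; NOT a proof of the stub); counted 0; AI-level work, weaker than expert review.] [folklore]
-/

-- single-problem summit: the doubled namespace component `ResolutionOfSingularities` is forced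
set_option linter.dupNamespace false

noncomputable section

open CategoryTheory AlgebraicGeometry TopologicalSpace IsLocalRing
open Literature.AlgebraicGeometry.Resolution Literature.AlgebraicGeometry.Ramification
open Scheme.IdealSheafData
open Summit.ResolutionOfSingularities.ResolutionOfSingularities.Theorems.WildQuotientResolution.PointBlowupStalkData
open Summit.ResolutionOfSingularities.ResolutionOfSingularities.Theorems.WildQuotientResolution.InertLocusStalk

namespace Summit.ResolutionOfSingularities.ResolutionOfSingularities.Theorems.WildQuotientResolution.StandardForm

/-! ## Support bookkeeping of a blow-up -/

section Support

variable {X X' : Scheme.{0}} [IsLocallyNoetherian X'] (π : X' ⟶ X) (C : X.IdealSheafData)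

/-- **The preimage of `V(K)` is carried by the strict transform and the exceptional divisor**: for a morphism
`π : X' → X` and ideal sheaves `C` (centre), `K` on `X`, `π⁻¹(supp K) ⊆ supp(strict transform of K) ∪ supp(C·𝒪_{X'})`
— off the exceptional locus the stalk of `C·𝒪_{X'}` is the unit ideal, so the saturation defining the strict
transform does nothing there. [folklore] -/
theorem preimage_support_subset_strict_union_exceptional (K : X.IdealSheafData) :
    π.base ⁻¹' (K.support : Set X) ⊆
      (strictTransformIdeal π C K).support ∪ ((C.comap π).support : Set X') := by
  intro x' hx'
  by_cases hE : x' ∈ (C.comap π).support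
  · exact Or.inr hE
  left
  rw [SetLike.mem_coe, mem_support_iff_stalkIdeal_le, stalkIdeal_strictTransformIdeal,
    stalkIdeal_eq_top_of_not_mem_support hE]
  refine iSup_le fun n => ?_
  rw [Ideal.top_pow, Submodule.top_coe, Submodule.colon_univ, ← stalkIdeal_comap_eq_map_stalkMap]
  have hx'' : x' ∈ (K.comap π).support := by
    rw [support_comap]
    exact hx'
  exact (mem_support_iff_stalkIdeal_le _ x').mp hx''

end Support

/-! ## Simple normal crossings of a tame inert locus with a stable SNC divisor -/

section SNC

variable {X : Scheme.{0}} {G : Type} [Group G] [Finite G] (σ : G →* Aut X)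
  (p : ℕ) [Fact p.Prime] (K : Subgroup G)

/-- **A tame inert locus has simple normal crossings with a stable simple normal crossings divisor** (crux
stmt-ResolutionOfSingularities-15640, toward `stub_phaseZeroHighDim`; any dimension). Let `G` act on the
locally Noetherian scheme `X` with residue fields of characteristic `p`;
let `K ≤ G` have order prime to `p` with closed inert locus `Z_K`; let `D` be an ideal sheaf with `HasSNC [D]`
whose support is `G`-stable. Then `HasSNCWith [D] (𝓘_{Z_K})`. [folklore] -/
theorem hasSNCWith_inertLocus_of_hasSNC_singleton
    (hchar : ∀ x : X, CharP (ResidueField (X.presheaf.stalk x)) p) (hcop : (Nat.card K).Coprime p)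
    (hZ : IsClosed {y : X | K ≤ inertiaSubgroup σ y}) (D : X.IdealSheafData) (hD : HasSNC [D])
    (hDstab : ∀ g : G, (σ g).hom.base ⁻¹' (D.support : Set X) = D.support) :
    HasSNCWith [D] (vanishingIdeal ⟨{y : X | K ≤ inertiaSubgroup σ y}, hZ⟩) := by
  classical
  set Z : Closeds X := ⟨{y : X | K ≤ inertiaSubgroup σ y}, hZ⟩ with hZdef
  have hDmem : D ∈ [D] := List.mem_singleton_self D
  intro x
  haveI := hchar x
  obtain ⟨hregx, u, hu, ⟨ι, hιinj, hι⟩, -⟩ := hD x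
  haveI := hregx
  by_cases hxZ : x ∈ (vanishingIdeal Z).support
  swap
  · -- off the centre: the snc data of `[D]` as given
    exact ⟨hregx, u, hu, ⟨ι, hιinj, hι⟩, fun h => absurd h hxZ⟩
  -- on the centre: `K ≤ I_x`, stalk action, `(𝓘_Z)_x = ⨆ 𝔞_k`
  have hKx : K ≤ inertiaSubgroup σ x := by
    have h : x ∈ (Z : Set X) := by
      rw [← Scheme.IdealSheafData.coe_support_vanishingIdeal (Z := Z)]; exact hxZ
    exact h
  obtain ⟨a, τ, hkey, hτ⟩ := exists_stalkAction σ x (inertiaSubgroup σ x)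
    (fun g hg => apply_eq_of_mem_inertiaSubgroup σ hg)
  have hKu : IsUnit ((Nat.card K : ℕ) : X.presheaf.stalk x) :=
    TameFixedLocus.isUnit_natCast_of_not_dvd p
      ((Nat.Prime.coprime_iff_not_dvd (Fact.out : p.Prime)).mp hcop.symm)
  have hJx : stalkIdeal (vanishingIdeal Z) x =
      ⨆ k : K, augIdeal ((τ.comp (Subgroup.inclusion hKx)) k) :=
    stalkIdeal_vanishingIdeal_inertLocus_of_isUnit σ x a τ hkey hτ hKx hKu hKx hZ
  have hm : (⨆ k : K, augIdeal ((τ.comp (Subgroup.inclusion hKx)) k)) ≤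
      maximalIdeal (X.presheaf.stalk x) :=
    (mem_inertLocus_iff_iSup_augIdeal_le σ x a τ hkey hτ hKx).mp hKx
  have hKu' : IsUnit ((Nat.card K : ℕ) : X.presheaf.stalk x) := hKu
  by_cases hxD : x ∈ D.support
  · -- through the boundary divisor: stable line `t`, labelled minimal basis through `t`
    set t : X.presheaf.stalk x := u (ι ⟨D, hDmem, hxD⟩) with htdef
    have ht : stalkIdeal D x = Ideal.span {t} := hι ⟨D, hDmem, hxD⟩
    have hrsop : IsRsopPart (u ∘ id) := isRsopPart_comp_of_rsop rfl u hu id Function.injective_id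
    have htm : t ∈ maximalIdeal (X.presheaf.stalk x) := hu ▸ Ideal.subset_span ⟨_, rfl⟩
    have ht2 : t ∉ maximalIdeal (X.presheaf.stalk x) ^ 2 := hrsop.not_mem_sq (ι ⟨D, hDmem, hxD⟩)
    have htE : stalkIdeal (vanishingIdeal D.support) x = Ideal.span {t} := by
      rw [hD.vanishingIdeal_support hDmem, ht]
    have hstab : ∀ k : K, (τ.comp (Subgroup.inclusion hKx)) k t ∈ Ideal.span {t} := by
      intro k
      rw [MonoidHom.comp_apply]
      have h := apply_mem_stalkIdeal_vanishingIdeal σ x a τ hkey hτ D.support (fun g => hDstab (g : G))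
        (Subgroup.inclusion hKx k) (htE ▸ Ideal.mem_span_singleton_self t)
      rwa [htE] at h
    obtain ⟨u', hu', ⟨i₀, hi₀⟩, S, hS⟩ :=
      exists_rsop_label_of_stableLine (τ.comp (Subgroup.inclusion hKx)) hKu' hm htm ht2 hstab
    refine ⟨hregx, u', hu', ⟨fun _ => i₀, fun D₁ D₂ _ => ?_, fun D' => ?_⟩, fun _ => ⟨S, ?_⟩⟩
    · exact Subtype.ext ((List.mem_singleton.mp D₁.2.1).trans (List.mem_singleton.mp D₂.2.1).symm)
    · have hD' : D'.1 = D := List.mem_singleton.mp D'.2.1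
      rw [hD', ht, hi₀]
    · rw [hJx, hS]
  · -- on the centre, off the boundary: any minimal basis generating the centre
    haveI : IsRegularLocalRing (X.presheaf.stalk x ⧸ stalkIdeal (vanishingIdeal Z) x) :=
      isRegularLocalRing_quotient_stalkIdeal_inertLocus σ x a τ hkey hτ hKx hKu hKx hZ
    have hJm : stalkIdeal (vanishingIdeal Z) x ≤ maximalIdeal _ := hJx ▸ hm
    obtain ⟨u', hu', S, hS⟩ := exists_rsop_of_isRegularLocalRing_quotient hJm
    have hempty : ∀ D' : {D' : X.IdealSheafData // D' ∈ [D] ∧ x ∈ D'.support}, False := fun D' =>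
      hxD ((List.mem_singleton.mp D'.2.1) ▸ D'.2.2)
    exact ⟨hregx, u', hu', ⟨fun D' => (hempty D').elim, fun D₁ => (hempty D₁).elim,
      fun D' => (hempty D').elim⟩, fun _ => ⟨S, hS⟩⟩

end SNC

end Summit.ResolutionOfSingularities.ResolutionOfSingularities.Theorems.WildQuotientResolution.StandardForm

end
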